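import Mathlib
import Summits.MatrixMultiplication.MatrixMultiplication.Theorems.FidelityWitnessesFidelityGapThreeSeventeenStubBorelNormalFormExpAlg
import Summits.MatrixMultiplication.MatrixMultiplication.Theorems.FidelityWitnessesFidelityGapThreeSeventeenStubBorelNormalFormTau
import Summits.MatrixMultiplication.MatrixMultiplication.Theorems.FidelityWitnessesFidelityGapThreeSeventeenStubBorelNormalFormBrackets
import Summits.MatrixMultiplication.MatrixMultiplication.Theorems.FidelityWitnessesFidelityGapThreeSeventeenStubBorelNormalFormTorusData
import Summits.MatrixMultiplication.MatrixMultiplication.Theorems.FidelityWitnessesFidelityGapThreeSeventeenStubBorelNormalFormGood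

/-!
# `stub_borelNormalForm`: Borel normal form for the truncated fat datum of `⟨3,3,3⟩` at `r = 17`

Line `symbolic-square-border-apolarity` of `FidelityWitnesses.FidelityGapThreeSeventeen`
(stmt-MatrixMultiplication-4958), stub S2: **if a fat border-apolarity candidate exists, then a
`𝔟`-fixed one exists** (Conner–Harper–Landsberg, Forum Math. Pi 11 (2023) e17 = arXiv:1911.07981, §2.4;
Buczyńska–Buczyński, Duke Math. J. 170 (2021), Thm. 4.3) — proved WITHOUT the Borel fixed point theorem,
by eighteen explicit one-parameter degenerations in the product of Grassmannians: nine root subgroups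
`exp(s E_{pq})`, `p < q` (order `E₀₂, E₀₁, E₁₂` in each factor `U, V, W`, compatible with a normal series of
the nilpotent part), then the nine one-parameter tori of the diagonal `E_{pp}`.  Each step replaces every
piece `I m` by the limit `lim_{s → ∞}` of its translates (parts 1–2: lattice, limit, dimension), is again a
fat candidate because every condition is closed and equivariant (part 10, using parts 3–9: the translates,
the invariance of `T3`, the commutation relations), keeps the stability already gained (inherited
stability) and gains its own generator.  The conclusion `AllBFixed` is stability under all `E_{pq}`,
`p ≤ q`, of the three factors.  PROVED, axioms `propext, Classical.choice, Quot.sound`.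
-/

noncomputable section

namespace Summit.MatrixMultiplication.MatrixMultiplication.Theorems.SymbolicSquare

-- single-conjunct summit: the `Summit.<S>.<P>` prefix repeats `MatrixMultiplication` by design (D-0017)
set_option linter.dupNamespace false

open scoped BigOperators Polynomial
open Polynomial

/-! ## The two kinds of limit steps and the Borel normal form -/

section Steps

open BorelLimit

/-- Powers of `-D` vanish where powers of `D` do. -/
theorem neg_pow_apply_eq_zero {D : Poly →ₗ[ℂ] Poly} {k : ℕ} {f : Poly} (h : (D ^ k) f = 0) : ((-D) ^ k) f = 0 := by
  rw [show -D = (-1 : ℂ) • D from (neg_one_smul ℂ D).symm, _root_.smul_pow, LinearMap.smul_apply, h, smul_zero]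

/-- Total degrees of the data multidegrees are at most `3`. -/
theorem tot_le_of_mem_degsData {m : MDeg} (hm : m ∈ degsData) : tot m ≤ 3 := by
  simp only [degsData, List.mem_cons, List.mem_nil_iff, or_false] at hm
  rcases hm with rfl | rfl | rfl | rfl | rfl | rfl | rfl | rfl | rfl | rfl | rfl | rfl | rfl <;> decide

/-- Quasi-inverse of the exponential package (symbolic truncation order `N ≥ 5`). -/
theorem exp_inv1 (X p q : Fin 3) (hpq : p ≠ q) (N : ℕ) (hN : 5 ≤ N) (m : MDeg) (hm : tot m ≤ 4) (F : Poly[X])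
    (hF : F ∈ famOf (S m)) : Hx (-opL X p q) N (Hx (opL X p q) N F) = Polynomial.X ^ (2 * N) * F := by
  have hnil : ∀ f ∈ S m, (opL X p q ^ (N + 1)) f = 0 :=
    fun f hf => opL_pow_eq_zero X p q hpq m hf (by simp only [tot] at hm; omega)
  exact Hx_neg_Hx (opL X p q) N hnil hF

/-- Quasi-inverse of the exponential package, other order. -/
theorem exp_inv2 (X p q : Fin 3) (hpq : p ≠ q) (N : ℕ) (hN : 5 ≤ N) (m : MDeg) (hm : tot m ≤ 4) (F : Poly[X])
    (hF : F ∈ famOf (S m)) : Hx (opL X p q) N (Hx (-opL X p q) N F) = Polynomial.X ^ (2 * N) * F := by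
  have hnil : ∀ f ∈ S m, (opL X p q ^ (N + 1)) f = 0 :=
    fun f hf => opL_pow_eq_zero X p q hpq m hf (by simp only [tot] at hm; omega)
  exact Hx_Hx_neg (opL X p q) N hnil hF

/-- Multiplicativity of the exponential package. -/
theorem exp_mul (X p q : Fin 3) (hpq : p ≠ q) (N : ℕ) (hN : 5 ≤ N) (m m' : MDeg) (hmm : tot m + tot m' ≤ 4)
    (F : Poly[X]) (hF : F ∈ famOf (S m)) (G : Poly[X]) (hG : G ∈ famOf (S m')) :
    Hx (-opL X p q) N F * Hx (-opL X p q) N G = Polynomial.X ^ N * Hx (-opL X p q) N (F * G) := by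
  have hleib : ∀ f g : Poly, (-opL X p q) (f * g) = (-opL X p q) f * g + f * (-opL X p q) g := by
    intro f g
    simp only [LinearMap.neg_apply, opL_leibniz]
    ring
  have ha : ∀ f ∈ S m, ((-opL X p q) ^ (tot m + 1)) f = 0 :=
    fun f hf => neg_pow_apply_eq_zero (opL_pow_eq_zero X p q hpq m hf le_rfl)
  have hb : ∀ g ∈ S m', ((-opL X p q) ^ (tot m' + 1)) g = 0 :=
    fun g hg => neg_pow_apply_eq_zero (opL_pow_eq_zero X p q hpq m' hg le_rfl)
  exact Hx_mul (-opL X p q) N hleib ha hb (by omega) hF hG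

/-- **The EXPONENTIAL limit package** of a non-diagonal operator `D = opL X p q` (`p ≠ q`): lattice test
`ε^N exp(-D/ε)`, translate `ε^N exp(D/ε)` (`N ≥ 5 > 4 ≥ |m|`). -/
def expPkg (X p q : Fin 3) (hpq : p ≠ q) (N : ℕ) (hN : 5 ≤ N) : LimPkg where
  Hb := Hx (-opL X p q) N
  H := Hx (opL X p q) N
  hX := Hx_X_mul _ N
  hXH := Hx_X_mul _ N
  hbS m _ hF := Hx_mem_famOf _ N (fun _ hf => Submodule.neg_mem _ (opL_mem_S X p q m hf)) hF
  hHS m _ hF := Hx_mem_famOf _ N (fun _ hf => opL_mem_S X p q m hf) hF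
  a _ := 2 * N
  inv1 := exp_inv1 X p q hpq N hN
  inv2 := exp_inv2 X p q hpq N hN
  c := N
  hmul := exp_mul X p q hpq N hN
  annb _ hF := Hx_mem_famOf _ N (fun _ hf => Submodule.neg_mem _ (opL_mem_ann X p q hf)) hF
  annH _ hF := Hx_mem_famOf _ N (fun _ hf => opL_mem_ann X p q hf) hF

/-- Unfolding lemma. -/
theorem expPkg_Hb (X p q : Fin 3) (hpq : p ≠ q) (N : ℕ) (hN : 5 ≤ N) : (expPkg X p q hpq N hN).Hb = Hx (-opL X p q) N :=
  rfl

/-- Quasi-inverse of the torus package. -/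
theorem tor_inv (w w' : Var → ℕ) (hw : ∀ v, w v + w' v = 2) (m : MDeg) (F : Poly[X]) (hF : F ∈ famOf (S m)) :
    (Tw w').toLinearMap ((Tw w).toLinearMap F) = Polynomial.X ^ (2 * tot m) * F :=
  Tw_Tw_eq w w' 2 hw (tot m) (famOf_mono (S_le_restrictSupport_degree m) hF)

/-- **The TORUS limit package** of the diagonal operator `opL X p p`: translate `x_v ↦ ε^{nT v} x_v`,
lattice test `x_v ↦ ε^{2 - nT v} x_v`. -/
def torPkg (X p : Fin 3) : LimPkg where
  Hb := (Tw (nT' X p)).toLinearMap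
  H := (Tw (nT X p)).toLinearMap
  hX F := Tw_X_mul _ F
  hXH F := Tw_X_mul _ F
  hbS m _ hF := Tw_mem_famOf _ (fun j _ hf => whc_mem_weightedHomogeneousSubmodule _ wt m j hf) hF
  hHS m _ hF := Tw_mem_famOf _ (fun j _ hf => whc_mem_weightedHomogeneousSubmodule _ wt m j hf) hF
  a m := 2 * tot m
  inv1 m _ F hF := tor_inv (nT X p) (nT' X p) (nT_add_nT' X p) m F hF
  inv2 m _ F hF := tor_inv (nT' X p) (nT X p) (fun v => by rw [add_comm]; exact nT_add_nT' X p v) m F hF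
  c := 0
  hmul m m' _ F _ G _ := by rw [pow_zero, one_mul]; exact (map_mul (Tw (nT' X p)) F G).symm
  annb _ hF := Tw_mem_famOf _ (fun j _ hf => whc_mem_ann _ (weight_nT'_ms X p) j hf) hF
  annH _ hF := Tw_mem_famOf _ (fun j _ hf => whc_mem_ann _ (weight_nT_ms X p) j hf) hF

/-- Unfolding lemma. -/
theorem torPkg_Hb (X p : Fin 3) : (torPkg X p).Hb = (Tw (nT' X p)).toLinearMap := rfl

/-- **Exponential step**: degenerate along `exp(s D)`, `D = opL X p q` (`p ≠ q`): the limit is again a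
fat candidate, keeps the stability under the already processed operators (given the bracket data), and
gains stability under `D`. -/
theorem step_exp (X p q : Fin 3) (hpq : p ≠ q) (N : ℕ) (hN : 5 ≤ N) (L : List (Fin 3 × Fin 3 × Fin 3))
    (I : MDeg → Submodule ℂ Poly) (hI : IsFatCandidate T3 17 I)
    (hL : ∀ i ∈ L, ∀ m ∈ degsData, ∀ f ∈ I m, opL i.1 i.2.1 i.2.2 f ∈ I m)
    (hB : ∀ i ∈ L, ∃ C : Poly →ₗ[ℂ] Poly,
      opL X p q ∘ₗ opL i.1 i.2.1 i.2.2 - opL i.1 i.2.1 i.2.2 ∘ₗ opL X p q = C ∧ opL X p q ∘ₗ C = C ∘ₗ opL X p q ∧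
        (∀ m, ∀ f ∈ S m, C f ∈ S m) ∧ (∀ m ∈ degsData, ∀ f ∈ I m, C f ∈ I m)) :
    ∃ I' : MDeg → Submodule ℂ Poly, IsFatCandidate T3 17 I' ∧
      ∀ i ∈ (X, p, q) :: L, ∀ m ∈ degsData, ∀ f ∈ I' m, opL i.1 i.2.1 i.2.2 f ∈ I' m := by
  refine ⟨fun m => limW (expPkg X p q hpq N hN).Hb (S m) (I m), good_lim _ I hI, ?_⟩
  intro i hi m hm f hf
  have htot := tot_le_of_mem_degsData hm
  simp only [tot] at htot
  rw [expPkg_Hb] at hf ⊢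
  rcases List.mem_cons.1 hi with rfl | hi'
  · exact limW_Hx_stable_self (D := opL X p q) (N := N) (fun g hg => opL_mem_S X p q m hg)
      (fun g hg => opL_pow_eq_zero X p q hpq m hg (by omega)) f hf
  · obtain ⟨C, hC1, hC2, hC3, hC4⟩ := hB i hi'
    refine limW_Hx_stable_of_bracket (D := -opL X p q) (N := N) (E := opL i.1 i.2.1 i.2.2) (C' := -C)
      ?_ ?_ (fun g hg => opL_mem_S _ _ _ m hg) (fun g hg => Submodule.neg_mem _ (hC3 m g hg))
      (fun g hg => neg_pow_apply_eq_zero (opL_pow_eq_zero X p q hpq m hg (by omega)))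
      (fun g hg => hL i hi' m hm g hg) (fun g hg => Submodule.neg_mem _ (hC4 m hm g hg)) f hf
    · rw [LinearMap.neg_comp, LinearMap.comp_neg, ← hC1]
      abel
    · rw [LinearMap.neg_comp, LinearMap.comp_neg, LinearMap.neg_comp, LinearMap.comp_neg, neg_neg, neg_neg, hC2]

/-- **Torus step**: degenerate along the one-parameter torus of `opL X p p`: the limit is again a fat
candidate, keeps the stability under all processed operators, and gains stability under `opL X p p`. -/
theorem step_tor (X p : Fin 3) (L : List (Fin 3 × Fin 3 × Fin 3)) (I : MDeg → Submodule ℂ Poly)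
    (hI : IsFatCandidate T3 17 I) (hL : ∀ i ∈ L, ∀ m ∈ degsData, ∀ f ∈ I m, opL i.1 i.2.1 i.2.2 f ∈ I m) :
    ∃ I' : MDeg → Submodule ℂ Poly, IsFatCandidate T3 17 I' ∧
      ∀ i ∈ (X, p, p) :: L, ∀ m ∈ degsData, ∀ f ∈ I' m, opL i.1 i.2.1 i.2.2 f ∈ I' m := by
  refine ⟨fun m => limW (torPkg X p).Hb (S m) (I m), good_lim _ I hI, ?_⟩
  intro i hi m hm f hf
  rw [torPkg_Hb] at hf ⊢
  have hSδ : S m ≤ MvPolynomial.restrictSupport ℂ {d | Finsupp.degree d = tot m} := S_le_restrictSupport_degree m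
  have hSw : ∀ j, ∀ g ∈ S m, MvPolynomial.weightedHomogeneousComponent (nT X p) j g ∈ S m :=
    fun j g hg => whc_mem_weightedHomogeneousSubmodule _ wt m j hg
  rcases List.mem_cons.1 hi with rfl | hi'
  · exact limW_Tw_stable_diag (nT X p) (nT' X p) 2 (nT_add_nT' X p) (tot m) hSδ hSw (opL X p p)
      (fun j => ⟨(j : ℂ) - ((tot m : ℕ) : ℂ), fun g hg => opL_self_whc X p m j hg⟩) f hf
  · obtain ⟨s₁, s₂, hs⟩ := opL_shift X p i.1 i.2.1 i.2.2
    refine limW_stable (Tw (nT' X p)).toLinearMap (opL i.1 i.2.1 i.2.2) (fun g hg => opL_mem_S _ _ _ m hg) s₁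
      (LinearMap.mulLeft ℂ (Polynomial.X ^ s₂) ∘ₗ cw (opL i.1 i.2.1 i.2.2)) ?_ ?_ f hf
    · intro G hG
      exact (X_pow_mul_mem_famOf s₂).2 (cw_mem_famOf _ (fun g hg => hL i hi' m hm g hg) hG)
    · intro F _
      simp only [LinearMap.comp_apply, LinearMap.mulLeft_apply, AlgHom.toLinearMap_apply]
      exact X_pow_mul_Tw_cw (nT' X p) (opL i.1 i.2.1 i.2.2) s₁ s₂
        (fun d r => MvPolynomial.restrictSupport_mono ℂ (fun d' hd' => hd'.1)
          (lvf_monomial_mem_shift _ _ _ (nT' X p) s₁ s₂ hs d r)) F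

/-- Bracket data for a commuting pair: `C = 0`. -/
theorem bracketData_zero {D E : Poly →ₗ[ℂ] Poly} {I : MDeg → Submodule ℂ Poly} (h : D ∘ₗ E - E ∘ₗ D = 0) :
    ∃ C : Poly →ₗ[ℂ] Poly, D ∘ₗ E - E ∘ₗ D = C ∧ D ∘ₗ C = C ∘ₗ D ∧
      (∀ m, ∀ f ∈ S m, C f ∈ S m) ∧ (∀ m ∈ degsData, ∀ f ∈ I m, C f ∈ I m) :=
  ⟨0, h, by simp, fun m f _ => by simp, fun m _ f _ => by simp⟩

/-- Bracket data for `[E₁₂, E₀₁] = E₀₂` (with `E₀₂` already processed). -/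
theorem bracketData_one (X : Fin 3) {I : MDeg → Submodule ℂ Poly}
    (h02 : ∀ m ∈ degsData, ∀ f ∈ I m, opL X 0 2 f ∈ I m) :
    ∃ C : Poly →ₗ[ℂ] Poly, opL X 1 2 ∘ₗ opL X 0 1 - opL X 0 1 ∘ₗ opL X 1 2 = C ∧ opL X 1 2 ∘ₗ C = C ∘ₗ opL X 1 2 ∧
      (∀ m, ∀ f ∈ S m, C f ∈ S m) ∧ (∀ m ∈ degsData, ∀ f ∈ I m, C f ∈ I m) := by
  refine ⟨opL X 0 2, by simpa using opL_bracket X 1 2 0 1, ?_, fun m f hf => opL_mem_S X 0 2 m hf, h02⟩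
  exact sub_eq_zero.1 (by simpa using opL_bracket X 1 2 0 2)

/-- `[E₀₁, E₀₂] = 0`. -/
theorem bracket_01_02 (X : Fin 3) : opL X 0 1 ∘ₗ opL X 0 2 - opL X 0 2 ∘ₗ opL X 0 1 = 0 := by
  simpa using opL_bracket X 0 1 0 2

/-- `[E₁₂, E₀₂] = 0`. -/
theorem bracket_12_02 (X : Fin 3) : opL X 1 2 ∘ₗ opL X 0 2 - opL X 0 2 ∘ₗ opL X 1 2 = 0 := by
  simpa using opL_bracket X 1 2 0 2

/-- Cross-factor brackets vanish. -/
theorem bracket_cross (X Y : Fin 3) (hXY : X ≠ Y) (p q p' q' : Fin 3) :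
    opL X p q ∘ₗ opL Y p' q' - opL Y p' q' ∘ₗ opL X p q = 0 :=
  sub_eq_zero.2 (opL_comm X Y hXY p q p' q')

/-- The final list of processed operators: all `E_{pq}`, `p ≤ q`, of the three factors. -/
def allIdx : List (Fin 3 × Fin 3 × Fin 3) :=
  [(2, 2, 2), (2, 1, 1), (2, 0, 0), (1, 2, 2), (1, 1, 1), (1, 0, 0), (0, 2, 2), (0, 1, 1), (0, 0, 0),
    (2, 1, 2), (2, 0, 1), (2, 0, 2), (1, 1, 2), (1, 0, 1), (1, 0, 2), (0, 1, 2), (0, 0, 1), (0, 0, 2)]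

/-- Every `(X, p, q)` with `p ≤ q` is in the final list. -/
theorem mem_allIdx (X p q : Fin 3) (h : p ≤ q) : (X, p, q) ∈ allIdx := by
  revert X p q
  decide

/-- Stage `U`: the three root subgroups of the first factor. -/
theorem stageU (I : MDeg → Submodule ℂ Poly) (hI : IsFatCandidate T3 17 I) :
    ∃ I' : MDeg → Submodule ℂ Poly, IsFatCandidate T3 17 I' ∧
      ∀ i ∈ [((0 : Fin 3), (1 : Fin 3), (2 : Fin 3)), (0, 0, 1), (0, 0, 2)], ∀ m ∈ degsData, ∀ f ∈ I' m,
        opL i.1 i.2.1 i.2.2 f ∈ I' m := by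
  have h02 : (0 : Fin 3) ≠ 2 := by decide
  have h01 : (0 : Fin 3) ≠ 1 := by decide
  have h12 : (1 : Fin 3) ≠ 2 := by decide
  obtain ⟨I₁, g₁, s₁⟩ := step_exp 0 0 2 h02 7 (by norm_num) [] I hI (by simp) (by simp)
  obtain ⟨I₂, g₂, s₂⟩ := step_exp 0 0 1 h01 7 (by norm_num) [(0, 0, 2)] I₁ g₁ s₁ (by
    intro i hi; simp only [List.mem_singleton] at hi; subst hi
    exact bracketData_zero (bracket_01_02 0))
  exact step_exp 0 1 2 h12 7 (by norm_num) [(0, 0, 1), (0, 0, 2)] I₂ g₂ s₂ (by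
    intro i hi; simp only [List.mem_cons, List.mem_nil_iff, or_false] at hi
    rcases hi with rfl | rfl
    · exact bracketData_one 0 (s₂ (0, 0, 2) (by simp))
    · exact bracketData_zero (bracket_12_02 0))

/-- Stage `V`: the three root subgroups of the second factor. -/
theorem stageV (I : MDeg → Submodule ℂ Poly) (hI : IsFatCandidate T3 17 I)
    (hs : ∀ i ∈ [((0 : Fin 3), (1 : Fin 3), (2 : Fin 3)), (0, 0, 1), (0, 0, 2)], ∀ m ∈ degsData, ∀ f ∈ I m,
        opL i.1 i.2.1 i.2.2 f ∈ I m) :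
    ∃ I' : MDeg → Submodule ℂ Poly, IsFatCandidate T3 17 I' ∧
      ∀ i ∈ [((1 : Fin 3), (1 : Fin 3), (2 : Fin 3)), (1, 0, 1), (1, 0, 2), (0, 1, 2), (0, 0, 1), (0, 0, 2)],
        ∀ m ∈ degsData, ∀ f ∈ I' m, opL i.1 i.2.1 i.2.2 f ∈ I' m := by
  have h02 : (0 : Fin 3) ≠ 2 := by decide
  have h01 : (0 : Fin 3) ≠ 1 := by decide
  have h12 : (1 : Fin 3) ≠ 2 := by decide
  have n01 : (1 : Fin 3) ≠ 0 := by decide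
  obtain ⟨I₄, g₄, s₄⟩ := step_exp 1 0 2 h02 7 (by norm_num) [(0, 1, 2), (0, 0, 1), (0, 0, 2)] I hI hs (by
    intro i hi; simp only [List.mem_cons, List.mem_nil_iff, or_false] at hi
    rcases hi with rfl | rfl | rfl <;> exact bracketData_zero (bracket_cross 1 0 n01 _ _ _ _))
  obtain ⟨I₅, g₅, s₅⟩ := step_exp 1 0 1 h01 7 (by norm_num) [(1, 0, 2), (0, 1, 2), (0, 0, 1), (0, 0, 2)] I₄ g₄ s₄ (by
    intro i hi; simp only [List.mem_cons, List.mem_nil_iff, or_false] at hi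
    rcases hi with rfl | rfl | rfl | rfl
    · exact bracketData_zero (bracket_01_02 1)
    all_goals exact bracketData_zero (bracket_cross 1 0 n01 _ _ _ _))
  exact step_exp 1 1 2 h12 7 (by norm_num) [(1, 0, 1), (1, 0, 2), (0, 1, 2), (0, 0, 1), (0, 0, 2)] I₅ g₅ s₅ (by
    intro i hi; simp only [List.mem_cons, List.mem_nil_iff, or_false] at hi
    rcases hi with rfl | rfl | rfl | rfl | rfl
    · exact bracketData_one 1 (s₅ (1, 0, 2) (by simp))
    · exact bracketData_zero (bracket_12_02 1)
    all_goals exact bracketData_zero (bracket_cross 1 0 n01 _ _ _ _))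

/-- Stage `W`: the three root subgroups of the third factor. -/
theorem stageW (I : MDeg → Submodule ℂ Poly) (hI : IsFatCandidate T3 17 I)
    (hs : ∀ i ∈ [((1 : Fin 3), (1 : Fin 3), (2 : Fin 3)), (1, 0, 1), (1, 0, 2), (0, 1, 2), (0, 0, 1), (0, 0, 2)],
        ∀ m ∈ degsData, ∀ f ∈ I m, opL i.1 i.2.1 i.2.2 f ∈ I m) :
    ∃ I' : MDeg → Submodule ℂ Poly, IsFatCandidate T3 17 I' ∧
      ∀ i ∈ [((2 : Fin 3), (1 : Fin 3), (2 : Fin 3)), (2, 0, 1), (2, 0, 2), (1, 1, 2), (1, 0, 1), (1, 0, 2), (0, 1, 2),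
        (0, 0, 1), (0, 0, 2)], ∀ m ∈ degsData, ∀ f ∈ I' m, opL i.1 i.2.1 i.2.2 f ∈ I' m := by
  have h02 : (0 : Fin 3) ≠ 2 := by decide
  have h01 : (0 : Fin 3) ≠ 1 := by decide
  have h12 : (1 : Fin 3) ≠ 2 := by decide
  have n21 : (2 : Fin 3) ≠ 1 := by decide
  have n20 : (2 : Fin 3) ≠ 0 := by decide
  obtain ⟨I₇, g₇, s₇⟩ := step_exp 2 0 2 h02 7 (by norm_num)
    [(1, 1, 2), (1, 0, 1), (1, 0, 2), (0, 1, 2), (0, 0, 1), (0, 0, 2)] I hI hs (by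
    intro i hi; simp only [List.mem_cons, List.mem_nil_iff, or_false] at hi
    rcases hi with rfl | rfl | rfl | rfl | rfl | rfl
    · exact bracketData_zero (bracket_cross 2 1 n21 _ _ _ _)
    · exact bracketData_zero (bracket_cross 2 1 n21 _ _ _ _)
    · exact bracketData_zero (bracket_cross 2 1 n21 _ _ _ _)
    · exact bracketData_zero (bracket_cross 2 0 n20 _ _ _ _)
    · exact bracketData_zero (bracket_cross 2 0 n20 _ _ _ _)
    · exact bracketData_zero (bracket_cross 2 0 n20 _ _ _ _))
  obtain ⟨I₈, g₈, s₈⟩ := step_exp 2 0 1 h01 7 (by norm_num)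
    [(2, 0, 2), (1, 1, 2), (1, 0, 1), (1, 0, 2), (0, 1, 2), (0, 0, 1), (0, 0, 2)] I₇ g₇ s₇ (by
    intro i hi; simp only [List.mem_cons, List.mem_nil_iff, or_false] at hi
    rcases hi with rfl | rfl | rfl | rfl | rfl | rfl | rfl
    · exact bracketData_zero (bracket_01_02 2)
    · exact bracketData_zero (bracket_cross 2 1 n21 _ _ _ _)
    · exact bracketData_zero (bracket_cross 2 1 n21 _ _ _ _)
    · exact bracketData_zero (bracket_cross 2 1 n21 _ _ _ _)
    · exact bracketData_zero (bracket_cross 2 0 n20 _ _ _ _)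
    · exact bracketData_zero (bracket_cross 2 0 n20 _ _ _ _)
    · exact bracketData_zero (bracket_cross 2 0 n20 _ _ _ _))
  exact step_exp 2 1 2 h12 7 (by norm_num)
    [(2, 0, 1), (2, 0, 2), (1, 1, 2), (1, 0, 1), (1, 0, 2), (0, 1, 2), (0, 0, 1), (0, 0, 2)] I₈ g₈ s₈ (by
    intro i hi; simp only [List.mem_cons, List.mem_nil_iff, or_false] at hi
    rcases hi with rfl | rfl | rfl | rfl | rfl | rfl | rfl | rfl
    · exact bracketData_one 2 (s₈ (2, 0, 2) (by simp))
    · exact bracketData_zero (bracket_12_02 2)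
    · exact bracketData_zero (bracket_cross 2 1 n21 _ _ _ _)
    · exact bracketData_zero (bracket_cross 2 1 n21 _ _ _ _)
    · exact bracketData_zero (bracket_cross 2 1 n21 _ _ _ _)
    · exact bracketData_zero (bracket_cross 2 0 n20 _ _ _ _)
    · exact bracketData_zero (bracket_cross 2 0 n20 _ _ _ _)
    · exact bracketData_zero (bracket_cross 2 0 n20 _ _ _ _))

/-- Stage `T₁`: the tori of the first factor. -/
theorem stageT1 (I : MDeg → Submodule ℂ Poly) (hI : IsFatCandidate T3 17 I)
    (hs : ∀ i ∈ [((2 : Fin 3), (1 : Fin 3), (2 : Fin 3)), (2, 0, 1), (2, 0, 2), (1, 1, 2), (1, 0, 1), (1, 0, 2), (0, 1, 2),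
        (0, 0, 1), (0, 0, 2)], ∀ m ∈ degsData, ∀ f ∈ I m, opL i.1 i.2.1 i.2.2 f ∈ I m) :
    ∃ I' : MDeg → Submodule ℂ Poly, IsFatCandidate T3 17 I' ∧
      ∀ i ∈ [((0 : Fin 3), (2 : Fin 3), (2 : Fin 3)), (0, 1, 1), (0, 0, 0), (2, 1, 2), (2, 0, 1), (2, 0, 2), (1, 1, 2),
        (1, 0, 1), (1, 0, 2), (0, 1, 2), (0, 0, 1), (0, 0, 2)], ∀ m ∈ degsData, ∀ f ∈ I' m, opL i.1 i.2.1 i.2.2 f ∈ I' m := by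
  obtain ⟨J₁, k₁, t₁⟩ := step_tor 0 0 _ I hI hs
  obtain ⟨J₂, k₂, t₂⟩ := step_tor 0 1 _ J₁ k₁ t₁
  exact step_tor 0 2 _ J₂ k₂ t₂

/-- Stage `T₂`: the tori of the second factor. -/
theorem stageT2 (I : MDeg → Submodule ℂ Poly) (hI : IsFatCandidate T3 17 I)
    (hs : ∀ i ∈ [((0 : Fin 3), (2 : Fin 3), (2 : Fin 3)), (0, 1, 1), (0, 0, 0), (2, 1, 2), (2, 0, 1), (2, 0, 2), (1, 1, 2),
        (1, 0, 1), (1, 0, 2), (0, 1, 2), (0, 0, 1), (0, 0, 2)], ∀ m ∈ degsData, ∀ f ∈ I m, opL i.1 i.2.1 i.2.2 f ∈ I m) :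
    ∃ I' : MDeg → Submodule ℂ Poly, IsFatCandidate T3 17 I' ∧
      ∀ i ∈ [((1 : Fin 3), (2 : Fin 3), (2 : Fin 3)), (1, 1, 1), (1, 0, 0), (0, 2, 2), (0, 1, 1), (0, 0, 0), (2, 1, 2),
        (2, 0, 1), (2, 0, 2), (1, 1, 2), (1, 0, 1), (1, 0, 2), (0, 1, 2), (0, 0, 1), (0, 0, 2)],
        ∀ m ∈ degsData, ∀ f ∈ I' m, opL i.1 i.2.1 i.2.2 f ∈ I' m := by
  obtain ⟨J₁, k₁, t₁⟩ := step_tor 1 0 _ I hI hs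
  obtain ⟨J₂, k₂, t₂⟩ := step_tor 1 1 _ J₁ k₁ t₁
  exact step_tor 1 2 _ J₂ k₂ t₂

/-- Stage `T₃`: the tori of the third factor; the final list is `allIdx`. -/
theorem stageT3 (I : MDeg → Submodule ℂ Poly) (hI : IsFatCandidate T3 17 I)
    (hs : ∀ i ∈ [((1 : Fin 3), (2 : Fin 3), (2 : Fin 3)), (1, 1, 1), (1, 0, 0), (0, 2, 2), (0, 1, 1), (0, 0, 0), (2, 1, 2),
        (2, 0, 1), (2, 0, 2), (1, 1, 2), (1, 0, 1), (1, 0, 2), (0, 1, 2), (0, 0, 1), (0, 0, 2)],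
        ∀ m ∈ degsData, ∀ f ∈ I m, opL i.1 i.2.1 i.2.2 f ∈ I m) :
    ∃ I' : MDeg → Submodule ℂ Poly, IsFatCandidate T3 17 I' ∧
      ∀ i ∈ allIdx, ∀ m ∈ degsData, ∀ f ∈ I' m, opL i.1 i.2.1 i.2.2 f ∈ I' m := by
  obtain ⟨J₁, k₁, t₁⟩ := step_tor 2 0 _ I hI hs
  obtain ⟨J₂, k₂, t₂⟩ := step_tor 2 1 _ J₁ k₁ t₁
  exact step_tor 2 2 _ J₂ k₂ t₂

/-- Stability under all indexed operators is `AllBFixed`. -/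
theorem allBFixed_of_stab (J : MDeg → Submodule ℂ Poly)
    (t : ∀ i ∈ allIdx, ∀ m ∈ degsData, ∀ f ∈ J m, opL i.1 i.2.1 i.2.2 f ∈ J m) : AllBFixed J := by
  intro m hm p q hpq
  refine ⟨fun f hf => ?_, fun f hf => ?_, fun f hf => ?_⟩
  · rw [opU_eq]; exact t (0, p, q) (mem_allIdx 0 p q hpq) m hm f hf
  · rw [opV_eq]; exact t (1, p, q) (mem_allIdx 1 p q hpq) m hm f hf
  · rw [opW_eq]; exact t (2, p, q) (mem_allIdx 2 p q hpq) m hm f hf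

/-- **Borel normal form for the truncated fat datum** (CHL arXiv:1911.07981 §2.4 / BB arXiv:1910.01944 Thm 4.3,
without a fixed point theorem): from any fat candidate, eighteen one-parameter degenerations (nine root
subgroups `exp(s E_{pq})`, `p < q`, in an order compatible with a normal series of `𝔫`, then nine
one-parameter tori) produce a fat candidate stable under the whole Borel subalgebra. Every condition of
`IsFatCandidate` is closed and equivariant, so it passes to each limit (`good_lim`); stability already
gained is inherited (`limW_Hx_stable_of_bracket`, `X_pow_mul_Tw_cw`), and each step gains its own
generator (`limW_Hx_stable_self`, `limW_Tw_stable_diag`). -/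
theorem stub_borelNormalForm : ∀ I : MDeg → Submodule ℂ Poly, IsFatCandidate T3 17 I →
    ∃ I' : MDeg → Submodule ℂ Poly, IsFatCandidate T3 17 I' ∧ AllBFixed I' := by
  intro I hI
  obtain ⟨I₁, h₁, s₁⟩ := stageU I hI
  obtain ⟨I₂, h₂, s₂⟩ := stageV I₁ h₁ s₁
  obtain ⟨I₃, h₃, s₃⟩ := stageW I₂ h₂ s₂
  obtain ⟨I₄, h₄, s₄⟩ := stageT1 I₃ h₃ s₃
  obtain ⟨I₅, h₅, s₅⟩ := stageT2 I₄ h₄ s₄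
  obtain ⟨I₆, h₆, s₆⟩ := stageT3 I₅ h₅ s₅
  exact ⟨I₆, h₆, allBFixed_of_stab I₆ s₆⟩

end Steps


end Summit.MatrixMultiplication.MatrixMultiplication.Theorems.SymbolicSquare

end
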